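/-
COR-CM (cell pub-hodgecm2, stage 2 of the Hodge ladder) — count-neutral kernel census (seat prover-pub-hodgecm2-b23-g37-0, binder
prover b23, gen 37; lane EVEN-SLICE, blanket `Census/EvenSlice*` (lead gen 10, HOME/INBOX.md l.8803); sequel of
`Census/EvenSliceOrbitCount.lean`).  Theorems only: two more instances of the orbit count `card_orbitsA_mul_eq` (any parity), the
non-cyclic even groups `ℤ/2 × ℤ/4` and `ℤ/2 × ℤ/6`; no definition, no certificate, no named fact, no geometry, no `sorry`; `decide` only
on closed numerals over the `8`, resp. `12`, group elements.  `Interfaces.lean` (C1), every E term, B01 and `Transposition/*` are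
untouched.  HC_CM is NOT proved anywhere in this cell; nothing here is a headline and nothing here produces a period.
-/
import Summits.HodgeConjecture.CorCM.Census.EvenSliceOrbitCount

/-!
# The orbit count of the faithful full slice: `A = ℤ/2 × ℤ/4` (`23`) and `A = ℤ/2 × ℤ/6` (`189`)

Instances of `EvenSliceOrbitCount.card_orbitsA_mul_eq` (`#OrbitsA A · 2|A| = Σ_y (2^{|A/ℤy|} − 2) + Σ_{ord y even} 2^{|A/ℤy|}`) for the
two smallest non-cyclic, non-elementary abelian groups of even order, by Lagrange (`|A / ℤy| · ord y = |A|`) and the element orders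
(`addOrderOf_eq_iff`, decided element by element):

* `A = ℤ/2 × ℤ/4` (orders `1, 2, 2, 2, 4, 4, 4, 4`): `#OrbitsA · 16 = (254 + 3·14 + 4·2) + (3·16 + 4·4) = 368`, **`#OrbitsA = 23`** — the
  Galois CM fields with group `ℤ/2 × ℤ/2 × ℤ/4` and `c ∉ Gal²` (`ℚ(ζ₄₀)`, `ℚ(ζ₄₈)`, `ℚ(ζ₆₀)`): `22` canonical squares;
* `A = ℤ/2 × ℤ/6` (orders `1, 2 ×3, 3 ×2, 6 ×6`): `#OrbitsA · 24 = (4094 + 3·62 + 2·14 + 6·2) + (3·64 + 6·4) = 4536`, **`#OrbitsA = 189`**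
  — group `(ℤ/2)² × ℤ/6` (`ℚ(ζ₅₆)`, `ℚ(ζ₇₂)`, `ℚ(ζ₈₄)`): `188` canonical squares, lit-andre-3's degree-24 row `(ℤ/2)² × ℤ/6: 188`.

All [folklore].

## References
* [Pohlmann1968] H. Pohlmann, Algebraic cycles on abelian varieties of complex multiplication type, Ann. of Math. 88 (1968), Thm 1.
* [Milne1999] J. S. Milne, Lefschetz motives and the Tate conjecture, Compositio Math. 117 (1999), Prop. 2.1, p. 54.
-/

namespace Summit.HodgeConjecture.CorCM.Census.EvenSliceOrbitCount

open Finset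
open Summit.HodgeConjecture.CorCM.Census.OddDegreeParityLaw

/-! ## §1 Lagrange in the form used -/

/-- `|A / ℤy| · ord y = |A|`. [folklore] -/
theorem card_quotient_mul_addOrderOf {A : Type} [AddCommGroup A] [Fintype A] (y : A) :
    Nat.card (A ⧸ AddSubgroup.zmultiples y) * addOrderOf y = Fintype.card A := by
  have hl := AddSubgroup.card_eq_card_quotient_mul_card_addSubgroup (AddSubgroup.zmultiples y)
  rw [Nat.card_zmultiples, Nat.card_eq_fintype_card (α := A)] at hl
  exact hl.symm

/-! ## §2 `A = ℤ/2 × ℤ/4` -/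

/-- The element orders of `ℤ/2 × ℤ/4`: `1` for `0`, `2` for the three non-zero elements killed by `2`, `4` otherwise. [folklore] -/
theorem addOrderOf_zmod_two_four (y : ZMod 2 × ZMod 4) :
    addOrderOf y = if y = 0 then 1 else if (2 : ℕ) • y = 0 then 2 else 4 := by
  by_cases h0 : y = 0
  · rw [if_pos h0, h0, addOrderOf_zero]
  rw [if_neg h0]
  by_cases h2 : (2 : ℕ) • y = 0
  · rw [if_pos h2]
    refine (addOrderOf_eq_iff (by norm_num)).mpr ⟨h2, fun m hm hm0 => ?_⟩
    interval_cases m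
    rwa [one_nsmul]
  · rw [if_neg h2]
    have h4 : (4 : ℕ) • y = 0 := by
      have key : ∀ z : ZMod 2 × ZMod 4, (4 : ℕ) • z = 0 := by decide
      exact key y
    refine (addOrderOf_eq_iff (by norm_num)).mpr ⟨h4, fun m hm hm0 => ?_⟩
    interval_cases m
    · rwa [one_nsmul]
    · exact h2
    · intro h3
      have key : ∀ z : ZMod 2 × ZMod 4, (3 : ℕ) • z = 0 → z = 0 := by decide
      exact h0 (key y h3)

/-- `ℤ/2 × ℤ/2 × ℤ/4` (`c = (1,0,0)`; `ℚ(ζ₄₀)`, `ℚ(ζ₄₈)`, `ℚ(ζ₆₀)`): `23` isogeny classes of simple CM abelian varieties other than `E`.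
[folklore] -/
theorem card_orbitsA_zmod_two_four : Nat.card (OrbitsA (ZMod 2 × ZMod 4)) = 23 := by
  have h := card_orbitsA_mul_eq (ZMod 2 × ZMod 4)
  have hq : ∀ y : ZMod 2 × ZMod 4, Nat.card ((ZMod 2 × ZMod 4) ⧸ AddSubgroup.zmultiples y) =
      if y = 0 then 8 else if (2 : ℕ) • y = 0 then 4 else 2 := by
    intro y
    have hl := card_quotient_mul_addOrderOf y
    rw [addOrderOf_zmod_two_four, Fintype.card_prod, ZMod.card, ZMod.card] at hl
    split_ifs at hl ⊢ <;> omega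
  have hfilt : univ.filter (fun y : ZMod 2 × ZMod 4 => Even (addOrderOf y)) =
      univ.filter (fun y : ZMod 2 × ZMod 4 => Even (if y = 0 then 1 else if (2 : ℕ) • y = 0 then 2 else 4)) :=
    Finset.filter_congr (fun y _ => by rw [addOrderOf_zmod_two_four])
  simp_rw [hq] at h
  rw [hfilt] at h
  have hs1 : (∑ y : ZMod 2 × ZMod 4, (2 ^ (if y = 0 then 8 else if (2 : ℕ) • y = 0 then 4 else 2) - 2)) = 304 := by decide
  have hs2 : (∑ y ∈ univ.filter (fun y : ZMod 2 × ZMod 4 => Even (if y = 0 then 1 else if (2 : ℕ) • y = 0 then 2 else 4)),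
      2 ^ (if y = 0 then 8 else if (2 : ℕ) • y = 0 then 4 else 2)) = 64 := by decide
  rw [hs1, hs2, Fintype.card_prod, ZMod.card, ZMod.card] at h
  omega

/-! ## §3 `A = ℤ/2 × ℤ/6` -/

/-- The element orders of `ℤ/2 × ℤ/6`: `1`, `2` (non-zero, killed by `2`), `3` (non-zero, killed by `3`), `6` otherwise. [folklore] -/
theorem addOrderOf_zmod_two_six (y : ZMod 2 × ZMod 6) :
    addOrderOf y = if y = 0 then 1 else if (2 : ℕ) • y = 0 then 2 else if (3 : ℕ) • y = 0 then 3 else 6 := by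
  by_cases h0 : y = 0
  · rw [if_pos h0, h0, addOrderOf_zero]
  rw [if_neg h0]
  have h6 : (6 : ℕ) • y = 0 := by
    have key : ∀ z : ZMod 2 × ZMod 6, (6 : ℕ) • z = 0 := by decide
    exact key y
  by_cases h2 : (2 : ℕ) • y = 0
  · rw [if_pos h2]
    refine (addOrderOf_eq_iff (by norm_num)).mpr ⟨h2, fun m hm hm0 => ?_⟩
    interval_cases m
    rwa [one_nsmul]
  rw [if_neg h2]
  by_cases h3 : (3 : ℕ) • y = 0
  · rw [if_pos h3]
    refine (addOrderOf_eq_iff (by norm_num)).mpr ⟨h3, fun m hm hm0 => ?_⟩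
    interval_cases m
    · rwa [one_nsmul]
    · exact h2
  · rw [if_neg h3]
    refine (addOrderOf_eq_iff (by norm_num)).mpr ⟨h6, fun m hm hm0 => ?_⟩
    interval_cases m
    · rwa [one_nsmul]
    · exact h2
    · exact h3
    · intro h4
      have key : ∀ z : ZMod 2 × ZMod 6, (4 : ℕ) • z = 0 → (2 : ℕ) • z = 0 := by decide
      exact h2 (key y h4)
    · intro h5
      have key : ∀ z : ZMod 2 × ZMod 6, (5 : ℕ) • z = 0 → z = 0 := by decide
      exact h0 (key y h5)

/-- `ℤ/2 × ℤ/2 × ℤ/6` (`c = (1,0,0)`; `ℚ(ζ₅₆)`, `ℚ(ζ₇₂)`, `ℚ(ζ₈₄)`): `189` isogeny classes of simple CM abelian varieties other than `E`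
(lit-andre-3's `188 = 189 − 1` generating orbits for `(ℤ/2)² × ℤ/6`). [folklore] -/
theorem card_orbitsA_zmod_two_six : Nat.card (OrbitsA (ZMod 2 × ZMod 6)) = 189 := by
  have h := card_orbitsA_mul_eq (ZMod 2 × ZMod 6)
  have hq : ∀ y : ZMod 2 × ZMod 6, Nat.card ((ZMod 2 × ZMod 6) ⧸ AddSubgroup.zmultiples y) =
      if y = 0 then 12 else if (2 : ℕ) • y = 0 then 6 else if (3 : ℕ) • y = 0 then 4 else 2 := by
    intro y
    have hl := card_quotient_mul_addOrderOf y
    rw [addOrderOf_zmod_two_six, Fintype.card_prod, ZMod.card, ZMod.card] at hl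
    split_ifs at hl ⊢ <;> omega
  have hfilt : univ.filter (fun y : ZMod 2 × ZMod 6 => Even (addOrderOf y)) =
      univ.filter (fun y : ZMod 2 × ZMod 6 =>
        Even (if y = 0 then 1 else if (2 : ℕ) • y = 0 then 2 else if (3 : ℕ) • y = 0 then 3 else 6)) :=
    Finset.filter_congr (fun y _ => by rw [addOrderOf_zmod_two_six])
  simp_rw [hq] at h
  rw [hfilt] at h
  have hs1 : (∑ y : ZMod 2 × ZMod 6,
      (2 ^ (if y = 0 then 12 else if (2 : ℕ) • y = 0 then 6 else if (3 : ℕ) • y = 0 then 4 else 2) - 2)) = 4320 := by decide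
  have hs2 : (∑ y ∈ univ.filter (fun y : ZMod 2 × ZMod 6 =>
        Even (if y = 0 then 1 else if (2 : ℕ) • y = 0 then 2 else if (3 : ℕ) • y = 0 then 3 else 6)),
      2 ^ (if y = 0 then 12 else if (2 : ℕ) • y = 0 then 6 else if (3 : ℕ) • y = 0 then 4 else 2)) = 216 := by decide
  rw [hs1, hs2, Fintype.card_prod, ZMod.card, ZMod.card] at h
  omega

end Summit.HodgeConjecture.CorCM.Census.EvenSliceOrbitCount
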